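import Mathlib
import HarnessLib
import Literature.Analysis.PDE.BanachIndicatrixLaplacianBound
import Summits.NavierStokesRegularity.NavierStokesRegularity.Theorems.UnthreadedDoorIndicatrixBanachIndicatrixInvariance
import Summits.NavierStokesRegularity.NavierStokesRegularity.Theorems.UnthreadedDoorIndicatrixBanachIndicatrixTools
import Summits.NavierStokesRegularity.NavierStokesRegularity.Theorems.UnthreadedDoorIndicatrixSphereSupBounds
import Summits.NavierStokesRegularity.NavierStokesRegularity.Theorems.UnthreadedDoorIndicatrixSphereLaplacianLink

/-!
# Route `UnthreadedDoor`, crux `PoloidalLiouville` (stmt-NavierStokesRegularity-1222), WALL W1 — crux idea «indicatrix-bound»: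
# Λ-0b+c `IndicatrixLeHessian` ⇐ Polterovich–Sodin 2007 Thm 1.5, BY NAME (the M-Lean bridge (i)–(v), assembled)

★★ `indicatrixLeHessian_of : Literature.Analysis.PDE.PolterovichSodin2007_indicatrix_sphere → <IndicatrixLeHessian body VERBATIM>` — the registered
stub `stub_indicatrixLeHessian : PolterovichSodin2007_indicatrix_sphere → IndicatrixLeHessian` of `Cruxes/PoloidalLiouville/IndicatrixSketch.lean` v1.7.6
(custodian ns-idea-14), with the Prop unfolded (the sketch's `indicatrix` IS `Literature.Analysis.PDE.banachIndicatrix` by its kernel lemma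
`indicatrix_eq_banachIndicatrix`, `rfl`), so the sketch closes it by the bare term
`theorem stub_indicatrixLeHessian := Theorems.PoloidalLiouville.Indicatrix.indicatrixLeHessian_of`.

THE BRIDGE (docstring of `IndicatrixLeHessian`, steps (i)–(v)): for `u ∈ C²(ℝ³; ℝ³)`, `f` analytic off `x₀`, `curl u = ∇f × (x − x₀)`, `‖D²u‖ ≤ K` on
`S_r(x₀)` (`r > 0`): pick a maximiser `x⋆` of `f` on `S_r(x₀)` (`NetFlux.exists_mem_sphArgmax`) and put `g σ := f(x₀ + r σ) − f(x⋆)`;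
(ii)(iii) `Λ_{S_r(x₀)}(f) = Λ_{S²}(g)` (`banachIndicatrix_sphere_affine`, `banachIndicatrix_sub_const`, ns-qj-p1 g8, p729824);
PS07 on `S²`: `Λ_{S²}(g) ≤ k (‖g‖_{L²(sphereArea)} + ‖Δ_{S²} g‖_{L²(sphereArea)})`;
(iv) `|g| ≤ π · (π r ‖curlCLM‖ K)` on `S²` (`curl u x⋆ = 0` by Lagrange, great-circle mean value inside `S_r`, NF-0's arc bound: `abs_sub_le_on_sphere`);
(v) `|Δ_{S²} g| ≤ r ‖curlCLM‖² K` on `S²` (`Δ_{S²} g(σ) = −⟪rσ, curl curl u⟫`: `abs_sphereLaplacian_slice_le`);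
both `L²(sphereArea)` norms `≤ (sphereArea univ)^{1/2} · sup` with `sphereArea univ < ∞` (`eLpNorm_sphereArea_le_of_bound`, `sphereArea_univ_lt_top`).
CONSTANT: `C := k · ((sphereArea univ)^{1/2}).toReal · (π²‖curlCLM‖ + ‖curlCLM‖²)` — PS07's `k` refers to `eLpNorm · 2 sphereArea` with
`sphereArea = μH[2]⌊S²` (Mathlib's unnormalised Hausdorff measure, the typer's convention); no value of the area is used, only its finiteness.

HONEST LABEL: a PS07 bridge = calculus + topology strictly below W1; PS07 stays the ONE registered Literature fact (hypothesis, D-0026); information-grade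
support on ⟨1222⟩; `stub_scalarLiouville`, `PoloidalLiouville` ⟨1222⟩, W1 and NS regularity OPEN — NOT proved.
`--supports stmt-NavierStokesRegularity-1222 --as helper`.  [folklore]
-/

noncomputable section

-- the summit and its single sub-problem share the name (CONVENTIONS §1)
set_option linter.dupNamespace false

open Set Function Filter Topology MeasureTheory
open scoped RealInnerProductSpace ENNReal

namespace Summit.NavierStokesRegularity.NavierStokesRegularity.Theorems.PoloidalLiouville.Indicatrix

open Summit.NavierStokesRegularity.NavierStokesRegularity.Theorems.PoloidalLiouville.NetFlux
  (E3 sphArgmax sphArgmax_subset_sphere exists_mem_sphArgmax ne_center_of_mem_sphere)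
open Literature.Analysis Literature.Analysis.FluidPDE Literature.Analysis.PDE

/-- ★★ **Λ-0b+c `IndicatrixLeHessian` from Polterovich–Sodin 2007 Thm 1.5 (body of the sketch Prop VERBATIM, `indicatrix` = `banachIndicatrix`)**:
there is an absolute constant `C ≥ 0` such that for every `C²` field `u`, every slice potential `f` analytic off `x₀` with `curl u = ∇f × (x − x₀)`,
every `r > 0` and every bound `‖D²u‖ ≤ K` on `S_r(x₀)`: `Λ_{S_r(x₀)}(f) ≤ C · r · K` (Polterovich–Sodin 2007 Thm 1.5 enters only as the
hypothesis `hPS`, the registered Literature fact `PolterovichSodin2007_indicatrix_sphere`). [folklore] -/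
theorem indicatrixLeHessian_of (hPS : PolterovichSodin2007_indicatrix_sphere) :
    ∃ C : ℝ, 0 ≤ C ∧ ∀ (u : E3 → E3) (x₀ : E3) (f : E3 → ℝ) (r K : ℝ), 0 < r →
      ContDiff ℝ 2 u → AnalyticOnNhd ℝ f ({x₀}ᶜ : Set E3) →
      (∀ x, curl u x = cross (gradient f x) (x - x₀)) →
      (∀ x ∈ Metric.sphere x₀ r, ‖iteratedFDeriv ℝ 2 u x‖ ≤ K) →
      banachIndicatrix (Metric.sphere x₀ r) f ≤ ENNReal.ofReal (C * r * K) := by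
  obtain ⟨k, hk0, hk⟩ := hPS
  -- the finite total mass of `sphereArea` and the operator norm of the curl
  set m : ℝ≥0∞ := sphereArea (Set.univ : Set E3) ^ (2 : ℝ)⁻¹ with hm
  have hmfin : m ≠ ⊤ := (ENNReal.rpow_lt_top_of_nonneg (by positivity) sphereArea_univ_lt_top.ne).ne
  set M : ℝ := m.toReal with hM
  have hM0 : 0 ≤ M := ENNReal.toReal_nonneg
  have hmM : m = ENNReal.ofReal M := (ENNReal.ofReal_toReal hmfin).symm
  set κ : ℝ := ‖curlCLM‖ with hκ
  have hκ0 : 0 ≤ κ := norm_nonneg curlCLM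
  refine ⟨k * M * (Real.pi * (Real.pi * κ) + κ * κ), by positivity, ?_⟩
  intro u x₀ f r K hr hu hf hlink hK
  -- `K ≥ 0` (the sphere is nonempty)
  obtain ⟨x₁, hx₁⟩ := (NormedSpace.sphere_nonempty (x := x₀) (r := r)).mpr hr.le
  have hK0 : 0 ≤ K := (norm_nonneg _).trans (hK x₁ hx₁)
  -- a maximiser of `f` on the sphere; there `curl u` vanishes (Lagrange)
  have hsub : Metric.sphere x₀ r ⊆ ({x₀}ᶜ : Set E3) := fun x hx => ne_center_of_mem_sphere hr hx
  have hfc : ContinuousOn f (Metric.sphere x₀ r) := hf.continuousOn.mono hsub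
  obtain ⟨xs, hxs⟩ := exists_mem_sphArgmax hfc hr.le
  have hxsS : xs ∈ Metric.sphere x₀ r := sphArgmax_subset_sphere _ _ _ hxs
  have hxs0 : xs ≠ x₀ := ne_center_of_mem_sphere hr hxsS
  have h0 : curl u xs = 0 := curl_eq_zero_of_mem_sphArgmax hr (hf xs hxs0).differentiableAt hxs (hlink xs)
  have hUD : UniqueDiffOn ℝ ({x₀}ᶜ : Set E3) := isOpen_compl_singleton.uniqueDiffOn
  have hf1 : ContDiffOn ℝ 1 f ({x₀}ᶜ : Set E3) := hf.contDiffOn hUD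
  -- (ii)(iii): pull back to the unit sphere and shift by `f x⋆`
  set g : E3 → ℝ := fun σ => f (x₀ + r • σ) - f xs with hg
  have hΛ : banachIndicatrix (Metric.sphere x₀ r) f = banachIndicatrix (Metric.sphere (0 : E3) 1) g := by
    rw [banachIndicatrix_sphere_affine x₀ hr f, hg, banachIndicatrix_sub_const]
  -- `g` is smooth off the origin
  have hA : ∀ σ : E3, σ ≠ 0 → x₀ + r • σ ≠ x₀ := fun σ hσ h => by
    have : r • σ = 0 := by simpa using h
    exact hσ ((smul_eq_zero.1 this).resolve_left hr.ne')
  have hgs : ContDiffOn ℝ (⊤ : ℕ∞) g ({0}ᶜ : Set E3) := by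
    have h1 : ContDiffOn ℝ (⊤ : ℕ∞) (fun σ : E3 => x₀ + r • σ) ({0}ᶜ : Set E3) :=
      (contDiff_const.add (contDiff_id.const_smul r)).contDiffOn
    have h2 : ContDiffOn ℝ (⊤ : ℕ∞) (fun σ : E3 => f (x₀ + r • σ)) ({0}ᶜ : Set E3) :=
      (hf.contDiffOn hUD).comp h1 fun σ hσ => hA σ hσ
    exact h2.sub contDiffOn_const
  -- points of the unit sphere go to points of `S_r(x₀)`
  have hmem : ∀ σ ∈ Metric.sphere (0 : E3) 1, x₀ + r • σ ∈ Metric.sphere x₀ r := fun σ hσ => by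
    rw [mem_sphere_zero_iff_norm] at hσ
    rw [mem_sphere_iff_norm, add_sub_cancel_left, norm_smul, Real.norm_eq_abs, abs_of_pos hr, hσ, mul_one]
  -- (iv) zeroth order: `|g| ≤ π (π r κ K)` on `S²`
  have hg0 : ∀ σ ∈ Metric.sphere (0 : E3) 1, |g σ| ≤ Real.pi * (Real.pi * r * (κ * K)) := fun σ hσ =>
    abs_sub_le_on_sphere hr hu hf1 hlink hxsS h0 hK (hmem σ hσ) hxsS
  -- (v) second order: `|Δ_{S²} g| ≤ r κ² K` on `S²`
  have hg2 : ∀ σ ∈ Metric.sphere (0 : E3) 1, |sphereLaplacian g σ| ≤ r * (κ * (κ * K)) := fun σ hσ => by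
    have hσ1 : ‖σ‖ = 1 := mem_sphere_zero_iff_norm.1 hσ
    have hσ0 : σ ≠ 0 := by
      intro h; rw [h, norm_zero] at hσ1; exact zero_ne_one hσ1
    have hfx : ContDiffAt ℝ 2 f (x₀ + r • σ) := (hf _ (hA σ hσ0)).contDiffAt
    exact abs_sphereLaplacian_slice_le hσ1 hr.le hu hfx hlink (hK _ (hmem σ hσ))
  -- the two `L²(sphereArea)` norms
  have hL0 : eLpNorm g 2 sphereArea ≤ m * ENNReal.ofReal (Real.pi * (Real.pi * r * (κ * K))) :=
    eLpNorm_sphereArea_le_of_bound hg0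
  have hL2 : eLpNorm (sphereLaplacian g) 2 sphereArea ≤ m * ENNReal.ofReal (r * (κ * (κ * K))) :=
    eLpNorm_sphereArea_le_of_bound hg2
  -- PS07 on the unit sphere and the bookkeeping
  have hPS := hk g hgs
  have hA0 : 0 ≤ Real.pi * (Real.pi * r * (κ * K)) := by positivity
  have hB0 : 0 ≤ r * (κ * (κ * K)) := by positivity
  rw [hΛ]
  calc banachIndicatrix (Metric.sphere (0 : E3) 1) g
      ≤ ENNReal.ofReal k * (eLpNorm g 2 sphereArea + eLpNorm (sphereLaplacian g) 2 sphereArea) := hPS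
    _ ≤ ENNReal.ofReal k * (m * ENNReal.ofReal (Real.pi * (Real.pi * r * (κ * K))) +
          m * ENNReal.ofReal (r * (κ * (κ * K)))) := by gcongr
    _ = ENNReal.ofReal (k * M * (Real.pi * (Real.pi * κ) + κ * κ) * r * K) := by
        rw [hmM, ← ENNReal.ofReal_mul hM0, ← ENNReal.ofReal_mul hM0, ← ENNReal.ofReal_add (by positivity) (by positivity),
          ← ENNReal.ofReal_mul hk0]
        congr 1
        ring

end Summit.NavierStokesRegularity.NavierStokesRegularity.Theorems.PoloidalLiouville.Indicatrix

end
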